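import Mathlib
import Summits.Ventures.PercRepro2.Defs
import Summits.Ventures.PercRepro2.Independence
import Summits.Ventures.PercRepro2.Harris
import Summits.Ventures.PercRepro2.Graph
import Summits.Ventures.PercRepro2.Events
import Summits.Ventures.PercRepro2.ZCTwoEdge
import Summits.Ventures.PercRepro2.ZCZeroWeight
import Summits.Ventures.PercRepro2.ZCReroute
import Summits.Ventures.PercRepro2.ZCContract
import Summits.Ventures.PercRepro2.ZCSeriesPointwise

/-!
# Series reduction of a non-mark vertex of degree two (blind cell PercRepro2, mine-a g26;
MINE-A.md §75)

A NON-mark vertex `v` joined to the rest only by `f₁ = xv` (weight `p₁`) and `f₂ = vy` (weight `p₂`)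
is invisible to every connection between vertices other than `v` once the two edges in series are
replaced by ONE edge `xy` of weight `p₁ p₂`: in the fixed-`(V, E)` vocabulary, re-route `f₁` to
`s(x, y)` with weight `p₁ p₂` and give `f₂` weight `0` (`v` becomes isolated).  For a cluster up-set
`𝓔` that is BLIND to `v` (`S ∈ 𝓔 ↔ S \ {v} ∈ 𝓔` — every principal up-set `{x ∈ C₁}` with `x ≠ v`,
every up-set of the other vertices) the whole (ZC) expression is the same in the two graphs
(`zc_expr_series`), so (ZC) on the series-reduced graph gives (ZC) on `G` for every `v`-blind up-set
— the «series contraction» ceiling of the coverage census of MINE-A.md §73.2 is a theorem for the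
principal up-sets.  Probabilities: `prob_two_pin` on `G`, one pin on `G'`, and the invariance of the
pinned events under the two edge weights (`prob_update_eq_of_invariant`); the pointwise
correspondences are `ZCSeriesPointwise`'s.  No definition; one seat.
-/

namespace Summit.Ventures.PercRepro2

section SeriesProb

variable {V : Type*} {E : Type*} [Fintype E] [DecidableEq E] {R : Type*} [CommRing R]

/-- An event invariant under the state of `f` has the same probability under `p[f ↦ c]` as under
`p`, for every `c`. -/
lemma prob_update_eq_of_invariant (p : E → R) (f : E) (c : R) {B : Set (Config E)}
    (hB : ∀ ω b, Function.update ω f b ∈ B ↔ ω ∈ B) :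
    prob (Function.update p f c) B = prob p B := by
  have h1 : ∀ q : E → R, prob (Function.update q f 1) B = prob q B := by
    intro q
    rw [prob_update_one_eq_shift]
    congr 1; ext ω; exact hB ω true
  have h0 : ∀ q : E → R, prob (Function.update q f 0) B = prob q B := by
    intro q
    rw [prob_update_zero_eq_shift]
    congr 1; ext ω; exact hB ω false
  rw [prob_eq_pin (Function.update p f c) B f, Function.update_idem, Function.update_idem, h1, h0,
    Function.update_self]
  ring

variable {f₁ f₂ : E}

omit [Fintype E] in
/-- Closing a set `D` commutes with the states of two edges outside `D`. -/
lemma closeSet_update_two (D : Finset E) (hD₁ : f₁ ∉ D) (hD₂ : f₂ ∉ D) (ω : Config E) (b₁ b₂ : Bool) :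
    D.piecewise (fun _ => false) (Function.update (Function.update ω f₁ b₁) f₂ b₂) =
      Function.update (Function.update (D.piecewise (fun _ => false) ω) f₁ b₁) f₂ b₂ := by
  rw [closeSet_update D hD₂, closeSet_update D hD₁]

omit [Fintype E] in
/-- The base configuration of `ω`: `D` closed, `f₁`, `f₂` closed. -/
lemma base_closed (D : Finset E) (hD₁ : f₁ ∉ D) (hD₂ : f₂ ∉ D) (hf : f₁ ≠ f₂) (ω : Config E) :
    let b := Function.update (Function.update (D.piecewise (fun _ => false) ω) f₁ false) f₂ false
    b f₁ = false ∧ b f₂ = false ∧ ∀ e ∈ D, b e = false := by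
  refine ⟨?_, ?_, ?_⟩
  · simp [Function.update_of_ne hf]
  · simp
  · intro e he
    have h₁ : e ≠ f₁ := fun h => hD₁ (h ▸ he)
    have h₂ : e ≠ f₂ := fun h => hD₂ (h ▸ he)
    simp only [Function.update_of_ne h₂, Function.update_of_ne h₁]
    exact closeSet_apply_of_mem D ω he

omit [Fintype E] in
/-- The base configuration ignores the states of `f₁` and `f₂`. -/
lemma base_update (D : Finset E) (hD₁ : f₁ ∉ D) (hD₂ : f₂ ∉ D) (hf : f₁ ≠ f₂) (ω : Config E)
    (f : E) (hff : f = f₁ ∨ f = f₂) (b : Bool) :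
    Function.update (Function.update (D.piecewise (fun _ => false) (Function.update ω f b)) f₁ false)
        f₂ false =
      Function.update (Function.update (D.piecewise (fun _ => false) ω) f₁ false) f₂ false := by
  rcases hff with rfl | rfl
  · rw [closeSet_update D hD₁, Function.update_idem]
  · rw [closeSet_update D hD₂, Function.update_comm hf.symm, Function.update_idem,
      Function.update_comm hf]

/-- **Series reduction, one event.**  `Z` an event of `(ends, p)`, `Z'` an event of the re-routed
graph; if on every configuration `ω₀` closed at `f₁`, `f₂` and at the other edges `D` of `v` the four
states correspond — `11 ↦ 1`, and `10`, `01`, `00 ↦ 0` — then `P_p(Z) = P_{p'}(Z')` with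
`p' = p[f₁ ↦ p f₁ · p f₂][f₂ ↦ 0]`. -/
theorem prob_series (p : E → R) (hf : f₁ ≠ f₂) (D : Finset E) (hD₁ : f₁ ∉ D) (hD₂ : f₂ ∉ D)
    (hDp : ∀ e ∈ D, p e = 0) {Z Z' : Set (Config E)}
    (h11 : ∀ ω₀ : Config E, ω₀ f₁ = false → ω₀ f₂ = false → (∀ e ∈ D, ω₀ e = false) →
      (Function.update (Function.update ω₀ f₁ true) f₂ true ∈ Z ↔ Function.update ω₀ f₁ true ∈ Z'))
    (h10 : ∀ ω₀ : Config E, ω₀ f₁ = false → ω₀ f₂ = false → (∀ e ∈ D, ω₀ e = false) →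
      (Function.update ω₀ f₁ true ∈ Z ↔ ω₀ ∈ Z'))
    (h01 : ∀ ω₀ : Config E, ω₀ f₁ = false → ω₀ f₂ = false → (∀ e ∈ D, ω₀ e = false) →
      (Function.update ω₀ f₂ true ∈ Z ↔ ω₀ ∈ Z'))
    (h00 : ∀ ω₀ : Config E, ω₀ f₁ = false → ω₀ f₂ = false → (∀ e ∈ D, ω₀ e = false) →
      (ω₀ ∈ Z ↔ ω₀ ∈ Z')) :
    prob p Z = prob (Function.update (Function.update p f₁ (p f₁ * p f₂)) f₂ 0) Z' := by
  set p' := Function.update (Function.update p f₁ (p f₁ * p f₂)) f₂ 0 with hp'def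
  have hp' : ∀ e ∈ D, p' e = 0 := fun e he => by
    have h₁ : e ≠ f₁ := fun h => hD₁ (h ▸ he)
    have h₂ : e ≠ f₂ := fun h => hD₂ (h ▸ he)
    rw [hp'def, Function.update_of_ne h₂, Function.update_of_ne h₁]; exact hDp e he
  have hpf₂ : p' f₂ = 0 := by rw [hp'def, Function.update_self]
  have hpf₁ : p' f₁ = p f₁ * p f₂ := by rw [hp'def, Function.update_of_ne hf, Function.update_self]
  -- the base configuration and the four events
  set base : Config E → Config E := fun ω =>
    Function.update (Function.update (D.piecewise (fun _ => false) ω) f₁ false) f₂ false with hbase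
  have hb : ∀ ω, base ω f₁ = false ∧ base ω f₂ = false ∧ ∀ e ∈ D, base ω e = false :=
    fun ω => base_closed D hD₁ hD₂ hf ω
  have e11 : {ω | D.piecewise (fun _ => false) (Function.update (Function.update ω f₁ true) f₂ true) ∈ Z}
      = {ω | Function.update (base ω) f₁ true ∈ Z'} := by
    ext ω
    simp only [Set.mem_setOf_eq]
    rw [closeSet_update_two D hD₁ hD₂, update_two_eq_state hf]
    exact h11 _ (hb ω).1 (hb ω).2.1 (hb ω).2.2
  have e10 : {ω | D.piecewise (fun _ => false) (Function.update (Function.update ω f₁ true) f₂ false) ∈ Z}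
      = {ω | base ω ∈ Z'} := by
    ext ω
    simp only [Set.mem_setOf_eq]
    rw [closeSet_update_two D hD₁ hD₂, update_two_eq_state hf]
    have : Function.update (Function.update (base ω) f₁ true) f₂ false = Function.update (base ω) f₁ true := by
      apply update_false_of_eq_false
      rw [Function.update_of_ne hf.symm]; exact (hb ω).2.1
    rw [this]
    exact h10 _ (hb ω).1 (hb ω).2.1 (hb ω).2.2
  have e01 : {ω | D.piecewise (fun _ => false) (Function.update (Function.update ω f₁ false) f₂ true) ∈ Z}
      = {ω | base ω ∈ Z'} := by
    ext ω
    simp only [Set.mem_setOf_eq]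
    rw [closeSet_update_two D hD₁ hD₂, update_two_eq_state hf, update_false_of_eq_false (hb ω).1]
    exact h01 _ (hb ω).1 (hb ω).2.1 (hb ω).2.2
  have e00 : {ω | D.piecewise (fun _ => false) (Function.update (Function.update ω f₁ false) f₂ false) ∈ Z}
      = {ω | base ω ∈ Z'} := by
    ext ω
    simp only [Set.mem_setOf_eq]
    rw [closeSet_update_two D hD₁ hD₂, update_two_eq_state hf, update_false_of_eq_false (hb ω).1,
      update_false_of_eq_false (hb ω).2.1]
    exact h00 _ (hb ω).1 (hb ω).2.1 (hb ω).2.2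
  -- the re-routed side
  have r1 : {ω | D.piecewise (fun _ => false) (Function.update (Function.update ω f₁ true) f₂ false) ∈ Z'}
      = {ω | Function.update (base ω) f₁ true ∈ Z'} := by
    ext ω
    simp only [Set.mem_setOf_eq]
    rw [closeSet_update_two D hD₁ hD₂, update_two_eq_state hf]
    have : Function.update (Function.update (base ω) f₁ true) f₂ false = Function.update (base ω) f₁ true := by
      apply update_false_of_eq_false
      rw [Function.update_of_ne hf.symm]; exact (hb ω).2.1
    rw [this]
  have r0 : {ω | D.piecewise (fun _ => false) (Function.update (Function.update ω f₁ false) f₂ false) ∈ Z'}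
      = {ω | base ω ∈ Z'} := by
    ext ω
    simp only [Set.mem_setOf_eq]
    rw [closeSet_update_two D hD₁ hD₂, update_two_eq_state hf, update_false_of_eq_false (hb ω).1,
      update_false_of_eq_false (hb ω).2.1]
  -- invariance of the two events under the states of `f₁`, `f₂`
  have inv1 : ∀ (f : E), (f = f₁ ∨ f = f₂) → ∀ ω b,
      (Function.update ω f b ∈ {ω | Function.update (base ω) f₁ true ∈ Z'} ↔
        ω ∈ {ω | Function.update (base ω) f₁ true ∈ Z'}) := by
    intro f hff ω b
    simp only [Set.mem_setOf_eq, hbase]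
    rw [base_update D hD₁ hD₂ hf ω f hff b]
  have inv0 : ∀ (f : E), (f = f₁ ∨ f = f₂) → ∀ ω b,
      (Function.update ω f b ∈ {ω | base ω ∈ Z'} ↔ ω ∈ {ω | base ω ∈ Z'}) := by
    intro f hff ω b
    simp only [Set.mem_setOf_eq, hbase]
    rw [base_update D hD₁ hD₂ hf ω f hff b]
  -- expand both sides
  rw [prob_eq_closeSet p D hDp Z, prob_two_pin p hf]
  simp only [Set.mem_setOf_eq]
  rw [e11, e10, e01, e00]
  rw [prob_eq_closeSet p' D hp' Z', prob_eq_closeOne_of_zero p' hpf₂, prob_eq_pin p' _ f₁, hpf₁,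
    prob_update_one_eq_shift p' f₁, prob_update_zero_eq_shift p' f₁]
  simp only [Set.mem_setOf_eq]
  rw [r1, r0]
  rw [hp'def, prob_update_eq_of_invariant _ f₂ 0 (inv1 f₂ (Or.inr rfl)),
    prob_update_eq_of_invariant _ f₁ _ (inv1 f₁ (Or.inl rfl)),
    prob_update_eq_of_invariant _ f₂ 0 (inv0 f₂ (Or.inr rfl)),
    prob_update_eq_of_invariant _ f₁ _ (inv0 f₁ (Or.inl rfl))]
  ring

end SeriesProb

section SeriesMain

variable {V : Type*} {E : Type*} [Fintype E] [DecidableEq E] {R : Type*} [CommRing R]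
  {ends : E → Sym2 V} {x v y : V} {f₁ f₂ : E}

/-- **Series reduction of (ZC).**  A non-mark vertex `v` joined to the rest only by `f₁ = xv` and
`f₂ = vy` (every other edge at `v` lies in the zero-weight set `D`); `𝓔` blind to `v`.  The (ZC)
expression of `(ends, p)` equals that of the re-routed graph `(ends[f₁ ↦ xy], p[f₁ ↦ p f₁ · p f₂][f₂ ↦ 0])`
— so (ZC) on the series-reduced graph gives (ZC) on `G` for every `v`-blind cluster up-set. -/
theorem zc_expr_series (p : E → R) (hf₁ : ends f₁ = s(x, v)) (hf₂ : ends f₂ = s(v, y)) (hxv : x ≠ v)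
    (hyv : y ≠ v) (hf : f₁ ≠ f₂) (D : Finset E) (hD₁ : f₁ ∉ D) (hD₂ : f₂ ∉ D)
    (hDp : ∀ e ∈ D, p e = 0) (hD : ∀ e, v ∈ ends e → e = f₁ ∨ e = f₂ ∨ e ∈ D)
    (a₁ a₃ o : V) (h₁ : a₁ ≠ v) (h₃ : a₃ ≠ v) (ho : o ≠ v) (𝓔 : Set (Set V))
    (hblind : ∀ S, S ∈ 𝓔 ↔ S \ {v} ∈ 𝓔) :
    let ends' := Function.update ends f₁ s(x, y)
    let p' := Function.update (Function.update p f₁ (p f₁ * p f₂)) f₂ 0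
    let e := connEvent ends a₁ a₃
    let L := connEvent ends a₁ o
    let U := clusterInEvent ends a₁ 𝓔
    let γ := connEvent ends a₃ o
    let e' := connEvent ends' a₁ a₃
    let L' := connEvent ends' a₁ o
    let U' := clusterInEvent ends' a₁ 𝓔
    let γ' := connEvent ends' a₃ o
    prob p (eᶜ ∩ Lᶜ ∩ γᶜ) * (prob p (U ∩ (e ∩ L)) - prob p U * prob p (e ∩ L))
      - prob p (eᶜ ∩ Lᶜ ∩ γ) * (prob p (U ∩ (e ∩ Lᶜ)) - prob p U * prob p (e ∩ Lᶜ))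
    = prob p' (e'ᶜ ∩ L'ᶜ ∩ γ'ᶜ) * (prob p' (U' ∩ (e' ∩ L')) - prob p' U' * prob p' (e' ∩ L'))
      - prob p' (e'ᶜ ∩ L'ᶜ ∩ γ') * (prob p' (U' ∩ (e' ∩ L'ᶜ)) - prob p' U' * prob p' (e' ∩ L'ᶜ)) := by
  intro ends' p' e L U γ e' L' U' γ'
  -- the atomic correspondences on a base configuration
  have hω : ∀ ω₀ : Config E, (∀ e ∈ D, ω₀ e = false) →
      ∀ e, v ∈ ends e → e = f₁ ∨ e = f₂ ∨ ω₀ e = false := by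
    intro ω₀ hD0 e he
    rcases hD e he with h | h | h
    · exact Or.inl h
    · exact Or.inr (Or.inl h)
    · exact Or.inr (Or.inr (hD0 e h))
  have key : ∀ (Z Z' : Set (Config E)),
      (∀ ω₀ : Config E, ω₀ f₁ = false → ω₀ f₂ = false → (∀ e ∈ D, ω₀ e = false) →
        (Function.update (Function.update ω₀ f₁ true) f₂ true ∈ Z ↔ Function.update ω₀ f₁ true ∈ Z') ∧
        (Function.update ω₀ f₁ true ∈ Z ↔ ω₀ ∈ Z') ∧ (Function.update ω₀ f₂ true ∈ Z ↔ ω₀ ∈ Z') ∧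
        (ω₀ ∈ Z ↔ ω₀ ∈ Z')) → prob p Z = prob p' Z' :=
    fun Z Z' h => prob_series p hf D hD₁ hD₂ hDp (fun ω₀ a b c => (h ω₀ a b c).1)
      (fun ω₀ a b c => (h ω₀ a b c).2.1) (fun ω₀ a b c => (h ω₀ a b c).2.2.1)
      (fun ω₀ a b c => (h ω₀ a b c).2.2.2)
  -- connection events between marks, cluster event of the root
  have ce : ∀ (u u' : V), u ≠ v → u' ≠ v → ∀ ω₀ : Config E, ω₀ f₁ = false → ω₀ f₂ = false →
      (∀ e ∈ D, ω₀ e = false) →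
      (Function.update (Function.update ω₀ f₁ true) f₂ true ∈ connEvent ends u u' ↔
        Function.update ω₀ f₁ true ∈ connEvent ends' u u') ∧
      (Function.update ω₀ f₁ true ∈ connEvent ends u u' ↔ ω₀ ∈ connEvent ends' u u') ∧
      (Function.update ω₀ f₂ true ∈ connEvent ends u u' ↔ ω₀ ∈ connEvent ends' u u') ∧
      (ω₀ ∈ connEvent ends u u' ↔ ω₀ ∈ connEvent ends' u u') := by
    intro u u' hu hu' ω₀ h₀₁ h₀₂ hD0
    simp only [mem_connEvent]
    exact ⟨series_conn_11 hf₁ hf₂ hxv hyv hf h₀₁ h₀₂ (hω ω₀ hD0) hu hu',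
      series_conn_10 hf₁ hxv h₀₁ h₀₂ (hω ω₀ hD0) hu hu',
      series_conn_01 hf₂ hyv h₀₁ h₀₂ (hω ω₀ hD0) hu hu', series_conn_00 h₀₁ u u'⟩
  have cU : ∀ ω₀ : Config E, ω₀ f₁ = false → ω₀ f₂ = false → (∀ e ∈ D, ω₀ e = false) →
      (Function.update (Function.update ω₀ f₁ true) f₂ true ∈ U ↔ Function.update ω₀ f₁ true ∈ U') ∧
      (Function.update ω₀ f₁ true ∈ U ↔ ω₀ ∈ U') ∧ (Function.update ω₀ f₂ true ∈ U ↔ ω₀ ∈ U') ∧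
      (ω₀ ∈ U ↔ ω₀ ∈ U') := by
    intro ω₀ h₀₁ h₀₂ hD0
    exact ⟨clusterInEvent_iff_of_blind (fun u hu =>
        series_conn_11 hf₁ hf₂ hxv hyv hf h₀₁ h₀₂ (hω ω₀ hD0) h₁ hu) hblind,
      clusterInEvent_iff_of_blind (fun u hu => series_conn_10 hf₁ hxv h₀₁ h₀₂ (hω ω₀ hD0) h₁ hu) hblind,
      clusterInEvent_iff_of_blind (fun u hu => series_conn_01 hf₂ hyv h₀₁ h₀₂ (hω ω₀ hD0) h₁ hu) hblind,
      clusterInEvent_iff_of_blind (fun u hu => series_conn_00 h₀₁ a₁ u) hblind⟩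
  have he := ce a₁ a₃ h₁ h₃
  have hL := ce a₁ o h₁ ho
  have hγ := ce a₃ o h₃ ho
  have k1 := key (eᶜ ∩ Lᶜ ∩ γᶜ) (e'ᶜ ∩ L'ᶜ ∩ γ'ᶜ) (fun ω₀ a b c => by
    obtain ⟨e1, e2, e3, e4⟩ := he ω₀ a b c
    obtain ⟨l1, l2, l3, l4⟩ := hL ω₀ a b c
    obtain ⟨g1, g2, g3, g4⟩ := hγ ω₀ a b c
    simp only [e, L, γ, e', L', γ', Set.mem_inter_iff, Set.mem_compl_iff, e1, e2, e3, e4, l1, l2, l3,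
      l4, g1, g2, g3, g4, and_self])
  have k2 := key (U ∩ (e ∩ L)) (U' ∩ (e' ∩ L')) (fun ω₀ a b c => by
    obtain ⟨e1, e2, e3, e4⟩ := he ω₀ a b c
    obtain ⟨l1, l2, l3, l4⟩ := hL ω₀ a b c
    obtain ⟨u1, u2, u3, u4⟩ := cU ω₀ a b c
    simp only [e, L, U, e', L', U', Set.mem_inter_iff, e1, e2, e3, e4, l1, l2, l3, l4, u1, u2, u3, u4,
      and_self])
  have k3 := key U U' cU
  have k4 := key (e ∩ L) (e' ∩ L') (fun ω₀ a b c => by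
    obtain ⟨e1, e2, e3, e4⟩ := he ω₀ a b c
    obtain ⟨l1, l2, l3, l4⟩ := hL ω₀ a b c
    simp only [e, L, e', L', Set.mem_inter_iff, e1, e2, e3, e4, l1, l2, l3, l4, and_self])
  have k5 := key (eᶜ ∩ Lᶜ ∩ γ) (e'ᶜ ∩ L'ᶜ ∩ γ') (fun ω₀ a b c => by
    obtain ⟨e1, e2, e3, e4⟩ := he ω₀ a b c
    obtain ⟨l1, l2, l3, l4⟩ := hL ω₀ a b c
    obtain ⟨g1, g2, g3, g4⟩ := hγ ω₀ a b c
    simp only [e, L, γ, e', L', γ', Set.mem_inter_iff, Set.mem_compl_iff, e1, e2, e3, e4, l1, l2, l3,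
      l4, g1, g2, g3, g4, and_self])
  have k6 := key (U ∩ (e ∩ Lᶜ)) (U' ∩ (e' ∩ L'ᶜ)) (fun ω₀ a b c => by
    obtain ⟨e1, e2, e3, e4⟩ := he ω₀ a b c
    obtain ⟨l1, l2, l3, l4⟩ := hL ω₀ a b c
    obtain ⟨u1, u2, u3, u4⟩ := cU ω₀ a b c
    simp only [e, L, U, e', L', U', Set.mem_inter_iff, Set.mem_compl_iff, e1, e2, e3, e4, l1, l2, l3,
      l4, u1, u2, u3, u4, and_self])
  have k7 := key (e ∩ Lᶜ) (e' ∩ L'ᶜ) (fun ω₀ a b c => by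
    obtain ⟨e1, e2, e3, e4⟩ := he ω₀ a b c
    obtain ⟨l1, l2, l3, l4⟩ := hL ω₀ a b c
    simp only [e, L, e', L', Set.mem_inter_iff, Set.mem_compl_iff, e1, e2, e3, e4, l1, l2, l3, l4,
      and_self])
  rw [k1, k2, k3, k4, k5, k6, k7]

/-- A principal up-set `{S ∣ x ∈ S}` with `x ≠ v` is blind to `v`. -/
lemma blind_principal {V : Type*} {x v : V} (hxv : x ≠ v) :
    ∀ S : Set V, S ∈ {S : Set V | x ∈ S} ↔ S \ {v} ∈ {S : Set V | x ∈ S} := by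
  intro S
  simp only [Set.mem_setOf_eq, Set.mem_sdiff, Set.mem_singleton_iff, hxv, not_false_eq_true, and_true]

/-- **(ZC) transfers along a series reduction**: (ZC) for `(a₁, a₃, o; 𝓔)` on the re-routed graph
`(ends[f₁ ↦ xy], p[f₁ ↦ p f₁ · p f₂][f₂ ↦ 0])` gives (ZC) on `G`, for every `v`-blind cluster up-set. -/
theorem zc_of_series [PartialOrder R] (p : E → R) (hf₁ : ends f₁ = s(x, v)) (hf₂ : ends f₂ = s(v, y)) (hxv : x ≠ v)
    (hyv : y ≠ v) (hf : f₁ ≠ f₂) (D : Finset E) (hD₁ : f₁ ∉ D) (hD₂ : f₂ ∉ D)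
    (hDp : ∀ e ∈ D, p e = 0) (hD : ∀ e, v ∈ ends e → e = f₁ ∨ e = f₂ ∨ e ∈ D)
    (a₁ a₃ o : V) (h₁ : a₁ ≠ v) (h₃ : a₃ ≠ v) (ho : o ≠ v) (𝓔 : Set (Set V))
    (hblind : ∀ S, S ∈ 𝓔 ↔ S \ {v} ∈ 𝓔)
    (h : let ends' := Function.update ends f₁ s(x, y)
      let p' := Function.update (Function.update p f₁ (p f₁ * p f₂)) f₂ 0
      let e' := connEvent ends' a₁ a₃
      let L' := connEvent ends' a₁ o
      let U' := clusterInEvent ends' a₁ 𝓔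
      let γ' := connEvent ends' a₃ o
      0 ≤ prob p' (e'ᶜ ∩ L'ᶜ ∩ γ'ᶜ) * (prob p' (U' ∩ (e' ∩ L')) - prob p' U' * prob p' (e' ∩ L'))
        - prob p' (e'ᶜ ∩ L'ᶜ ∩ γ') * (prob p' (U' ∩ (e' ∩ L'ᶜ)) - prob p' U' * prob p' (e' ∩ L'ᶜ))) :
    let e := connEvent ends a₁ a₃
    let L := connEvent ends a₁ o
    let U := clusterInEvent ends a₁ 𝓔
    let γ := connEvent ends a₃ o
    0 ≤ prob p (eᶜ ∩ Lᶜ ∩ γᶜ) * (prob p (U ∩ (e ∩ L)) - prob p U * prob p (e ∩ L))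
      - prob p (eᶜ ∩ Lᶜ ∩ γ) * (prob p (U ∩ (e ∩ Lᶜ)) - prob p U * prob p (e ∩ Lᶜ)) := by
  have key := zc_expr_series p hf₁ hf₂ hxv hyv hf D hD₁ hD₂ hDp hD a₁ a₃ o h₁ h₃ ho 𝓔 hblind
  intro e L U γ
  simp only at key h
  rw [key]
  exact h

end SeriesMain

end Summit.Ventures.PercRepro2
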